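import Mathlib
import Literature.Analysis.Complex.SimilarityPrinciple
import Literature.Analysis.Complex.DbarAlongCalculus
import HarnessLib

/-!
# The similarity principle, local form: dichotomy for `|∂̄ c| ≤ M |c|` on a ball

Localisation of `Literature/Analysis/Complex/SimilarityPrinciple.lean` to functions that are only
defined (smooth) near a point. Let `c : ℂ → ℂ` be smooth on the disc `B(ζ₂, 2ρ)` with
`‖∂̄ c‖ ≤ M ‖c‖` on `B̄(ζ₂, ρ)` (`∂̄ = dbarAlong 1`) and `c ζ₂ = 0`. Then EITHER `c` vanishes
identically near `ζ₂`, OR `ζ₂` is an isolated zero of `c` and the winding number of `c` along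
small circles about `ζ₂` is strictly positive (`similarity_local_dichotomy`; Wendl (2020), App. B
Thm B.20 / Cor B.21; McDuff–Salamon (2012), §2.3). This is the form consumed by positivity of
intersections of `J`-holomorphic curves: `c` = the normal coordinate of a second sheet
(`Literature/Geometry/Symplectic/JHolomorphicSheetDbar.lean`), and "isolated zero of positive
index" persists under `C⁰`-perturbation (`Literature/Topology/PlaneTopology/ZerosPersist.lean`).

Proof: translate `ζ₂` to `0` and multiply by a smooth cut-off `χ` (`= 1` on `B̄(0, 3ρ/4)`, `= 0`
off `B(0, ρ)`), so that `w = χ · c (ζ₂ + ·)` is smooth on all of `ℂ`, agrees with `c (ζ₂ + ·)` on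
`B(0, 3ρ/4)`, and hence satisfies `‖∂̄ w‖ ≤ M ‖w‖` on `‖η‖ ≤ ρ/2`; if `c` is not eventually zero
at `ζ₂` the global engine `similarity_isolated_zero` applies with radius `ρ/2` at `z₀ = 0`, and
its conclusion is translated back (`circleLoop ζ₂ ε t = ζ₂ + circleLoop 0 ε t`).

Provenance: `Theorems/SullivanDualTameOrBrodyR4HelperLocalZeroDichotomy.lean` of summit
`SmoothPoincare4` (crux `TameOrBrodyR4`, conclusion `wind ≠ 0`), re-homed (promotion event
3639839) with positivity; step W3 of the Literature proof of
`Literature.Geometry.Symplectic.jHolomorphicLimitOfEmbedded_isEmbedded`.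

## References

* C. Wendl, *Lectures on Contact 3-Manifolds, Holomorphic Curves and Intersection Theory* (2020),
  App. B, Thm B.20, Cor B.21. [Wendl2020]
* D. McDuff, D. Salamon, *J-holomorphic curves and symplectic topology*, 2nd ed. (2012), §2.3.
  [McDuffSalamon2012]
-/

noncomputable section

open scoped ContDiff Topology
open Filter Set Metric
open Literature.Topology.PlaneTopology

namespace Literature.Analysis.Complex

namespace Similarity

/-- `∂̄` is local and commutes with translations: if `w` agrees with `c (ζ₂ + ·)` near `η`, then
`∂̄ w (η) = ∂̄ c (ζ₂ + η)`. [folklore] -/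
theorem dbarAlong_one_eq_of_eventuallyEq_translate {w c : ℂ → ℂ} {ζ₂ η : ℂ}
    (h : w =ᶠ[𝓝 η] fun z => c (ζ₂ + z)) :
    dbarAlong 1 w η = dbarAlong 1 c (ζ₂ + η) := by
  rw [dbarAlong_apply, dbarAlong_apply, h.fderiv_eq, fderiv_comp_add_left]

/-- The cut-off product `χ · c (ζ₂ + ·)` is smooth on `ℂ` when `c` is smooth on `B(ζ₂, 2ρ)` and
`χ` is smooth and vanishes off `B(0, ρ)`. [folklore] -/
theorem contDiff_cutoff_mul {χ c : ℂ → ℂ} {ζ₂ : ℂ} {ρ : ℝ} (hρ : 0 < ρ) (hχ : ContDiff ℝ ∞ χ)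
    (hχ0 : ∀ z : ℂ, χ z ≠ 0 → ‖z‖ < ρ) (hc : ContDiffOn ℝ ∞ c (ball ζ₂ (2 * ρ))) :
    ContDiff ℝ ∞ fun z => χ z * c (ζ₂ + z) := by
  rw [contDiff_iff_contDiffAt]
  intro s
  by_cases hs : ‖s‖ < 2 * ρ
  · have hmem : ζ₂ + s ∈ ball ζ₂ (2 * ρ) := by
      rw [mem_ball, dist_eq_norm, add_sub_cancel_left]
      exact hs
    have hcs : ContDiffAt ℝ ∞ c (ζ₂ + s) := hc.contDiffAt (isOpen_ball.mem_nhds hmem)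
    have htr : ContDiffAt ℝ ∞ (fun z : ℂ => ζ₂ + z) s := contDiffAt_const.add contDiffAt_id
    exact hχ.contDiffAt.mul (hcs.comp s htr)
  · have h0 : (fun z => χ z * c (ζ₂ + z)) =ᶠ[𝓝 s] fun _ => 0 := by
      have hopen : IsOpen {z : ℂ | ρ < ‖z‖} := isOpen_lt continuous_const continuous_norm
      have hs' : s ∈ {z : ℂ | ρ < ‖z‖} := by
        show ρ < ‖s‖
        have := not_lt.1 hs
        linarith
      filter_upwards [hopen.mem_nhds hs'] with z hz
      have hχz : χ z = 0 := by
        by_contra hne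
        exact absurd (hχ0 z hne) (not_lt.2 (le_of_lt hz))
      rw [hχz, zero_mul]
    exact contDiffAt_const.congr_of_eventuallyEq h0

end Similarity

open Similarity in
/-- **Similarity principle, local dichotomy.** Let `c` be smooth on `B(ζ₂, 2ρ)` with
`‖∂̄ c‖ ≤ M ‖c‖` on `B̄(ζ₂, ρ)` and `c ζ₂ = 0`. Then either `c` vanishes identically near `ζ₂`, or
`ζ₂` is an isolated zero: there is `0 < ε < ρ` with `c ≠ 0` on `0 < ‖z - ζ₂‖ ≤ ε` and
`0 < wind (c ∘ circleLoop ζ₂ ε')` for every `0 < ε' ≤ ε` (positive index on all small circles).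
[cite: Wendl2020, App. B Thm B.20 and Cor B.21 (similarity principle)] -/
theorem similarity_local_dichotomy (c : ℂ → ℂ) (ζ₂ : ℂ) (ρ M : ℝ) (hρ : 0 < ρ)
    (hc : ContDiffOn ℝ ∞ c (ball ζ₂ (2 * ρ)))
    (hbound : ∀ ζ ∈ closedBall ζ₂ ρ, ‖dbarAlong 1 c ζ‖ ≤ M * ‖c ζ‖)
    (h0 : c ζ₂ = 0) :
    (∀ᶠ ζ in 𝓝 ζ₂, c ζ = 0) ∨
    ∃ ε : ℝ, 0 < ε ∧ ε < ρ ∧ (∀ z : ℂ, 0 < ‖z - ζ₂‖ → ‖z - ζ₂‖ ≤ ε → c z ≠ 0) ∧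
      ∀ ε' : ℝ, 0 < ε' → ε' ≤ ε → 0 < wind (fun t => c (circleLoop ζ₂ ε' t)) := by
  by_cases hev : ∀ᶠ ζ in 𝓝 ζ₂, c ζ = 0
  · exact Or.inl hev
  right
  -- a point of `B(ζ₂, ρ/2)` where `c ≠ 0`
  have hfreq : ∃ᶠ ζ in 𝓝 ζ₂, c ζ ≠ 0 := Filter.not_eventually.1 hev
  have hρ2 : 0 < ρ / 2 := by linarith
  obtain ⟨ζ₁, hζ₁ne, hζ₁⟩ := (hfreq.and_eventually (ball_mem_nhds ζ₂ hρ2)).exists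
  rw [dist_eq_norm] at hζ₁
  -- the cut-off and the localised function `w = χ · c (ζ₂ + ·)`
  obtain ⟨χ, hχ, -, hχ1, hχ0, -⟩ :=
    Similarity.exists_cutoff (ρm := 3 * ρ / 4) (ρ := ρ) (by linarith) (by linarith)
  set w : ℂ → ℂ := fun z => χ z * c (ζ₂ + z) with hw_def
  have hw : ContDiff ℝ ∞ w := contDiff_cutoff_mul hρ hχ hχ0 hc
  have hwc : ∀ z : ℂ, ‖z‖ ≤ 3 * ρ / 4 → w z = c (ζ₂ + z) := fun z hz => by
    simp only [hw_def, hχ1 z hz, one_mul]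
  have hgerm : ∀ η : ℂ, ‖η‖ < 3 * ρ / 4 → w =ᶠ[𝓝 η] fun z => c (ζ₂ + z) := fun η hη => by
    filter_upwards [isOpen_ball.mem_nhds (mem_ball_zero_iff.2 hη)] with z hz
    exact hwc z (le_of_lt (mem_ball_zero_iff.1 hz))
  -- the localised inequality `‖∂̄ w‖ ≤ M ‖w‖` on `‖η‖ ≤ ρ/2`
  have hbound' : ∀ η : ℂ, ‖η‖ ≤ ρ / 2 → ‖dbarAlong 1 w η‖ ≤ M * ‖w η‖ := by
    intro η hη
    rw [dbarAlong_one_eq_of_eventuallyEq_translate (hgerm η (by linarith)), hwc η (by linarith)]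
    apply hbound
    rw [mem_closedBall, dist_eq_norm, add_sub_cancel_left]
    linarith
  -- the engine, at `z₀ = 0` with radius `ρ/2`
  have hdw : ContDiff ℝ ∞ (dbarAlong 1 w) := contDiff_infty_dbarAlong hw 1
  obtain ⟨ε, hε, hερ, hne, -⟩ := similarity_isolated_zero w (dbarAlong 1 w) M (ρ / 2)
    hw hdw (fun _ => rfl) hbound' 0 (by simpa using hρ2)
    (by simp only [hw_def, add_zero, h0, mul_zero])
    ⟨ζ₁ - ζ₂, hζ₁, by rwa [hwc _ (by linarith), add_sub_cancel]⟩
  rw [norm_zero, zero_add] at hερ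
  -- positivity of the index on every circle of radius `ε' ≤ ε`
  have hwind : ∀ ε' : ℝ, 0 < ε' → ε' ≤ ε → 0 < wind (fun t => w (circleLoop 0 ε' t)) :=
    fun ε' hε' hε'ε => similarity_wind_pos w (dbarAlong 1 w) M (ρ / 2) hw hdw (fun _ => rfl)
      hbound' hε' (by rw [norm_zero, zero_add]; linarith) (by simp only [hw_def, add_zero, h0, mul_zero])
      fun z hz => hne z (by rw [hz]; exact hε') (by rw [hz]; exact hε'ε)
  -- translate back
  refine ⟨ε, hε, by linarith, fun z hz hzε => ?_, fun ε' hε' hε'ε => ?_⟩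
  · have h := hne (z - ζ₂) (by rwa [sub_zero]) (by rwa [sub_zero])
    rwa [hwc _ (by linarith), add_sub_cancel] at h
  · have key : (fun t => w (circleLoop 0 ε' t)) = fun t => c (circleLoop ζ₂ ε' t) := by
      funext t
      have hn : ‖circleLoop 0 ε' t‖ = ε' := by
        simpa [abs_of_pos hε'] using norm_circleLoop_sub_center 0 ε' t
      rw [hwc _ (by rw [hn]; linarith)]
      congr 1
      rw [circleLoop_apply, circleLoop_apply]
      ring
    have h := hwind ε' hε' hε'ε
    rwa [key] at h

/-- **Local similarity principle, non-eventually-zero form**: if moreover `c` is not identically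
zero near `ζ₂`, then `ζ₂` is an isolated zero of positive index. [cite: Wendl2020, App. B Thm B.20 and Cor B.21 (similarity principle)] -/
theorem similarity_local_isolated_zero (c : ℂ → ℂ) (ζ₂ : ℂ) (ρ M : ℝ) (hρ : 0 < ρ)
    (hc : ContDiffOn ℝ ∞ c (ball ζ₂ (2 * ρ)))
    (hbound : ∀ ζ ∈ closedBall ζ₂ ρ, ‖dbarAlong 1 c ζ‖ ≤ M * ‖c ζ‖)
    (h0 : c ζ₂ = 0) (hne : ∃ᶠ ζ in 𝓝 ζ₂, c ζ ≠ 0) :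
    ∃ ε : ℝ, 0 < ε ∧ ε < ρ ∧ (∀ z : ℂ, 0 < ‖z - ζ₂‖ → ‖z - ζ₂‖ ≤ ε → c z ≠ 0) ∧
      ∀ ε' : ℝ, 0 < ε' → ε' ≤ ε → 0 < wind (fun t => c (circleLoop ζ₂ ε' t)) :=
  (similarity_local_dichotomy c ζ₂ ρ M hρ hc hbound h0).resolve_left
    (Filter.not_eventually.2 hne)

end Literature.Analysis.Complex

end
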